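import Mathlib.Analysis.Calculus.MeanValue
import Mathlib.Analysis.Calculus.Deriv.MeanValue
import Mathlib.Topology.Order.Compact
import HarnessLib

/-!
# Hamilton's trick: the time derivative of a minimum over a compact set

Topic `Literature/Analysis/Calculus`. R. S. Hamilton's device (*Four-manifolds with positive
curvature operator*, J. Differential Geom. 24 (1986), Lemma 3.5; C. Mantegazza, *Lecture Notes on
Mean Curvature Flow* (2011), Lemma 2.1.3 "Hamilton's trick") for differentiating
`u(t) = min_{k ∈ K} φ(t, k)` over a COMPACT parameter space `K` when `φ` and `∂ₜφ` are jointly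
continuous: the derivative of the minimum is controlled by `∂ₜφ` AT THE MINIMISERS only. The
printed statement is "`u` is locally Lipschitz and at every differentiability time
`u'(t) ≥ inf {∂ₜφ(t, k) : k a minimiser of φ(t, ·)}`" (for maxima, `≤ sup`); we prove it in the
form that is actually used — a ONE-SIDED (lower right Dini) estimate valid at EVERY time, with no
appeal to Rademacher's theorem — together with its standard consequence, the monotonicity of the
minimum when `∂ₜφ ≥ 0` at minimisers (the form in which it enters the comparison / avoidance
principle for mean curvature flow, Mantegazza 2011, Thm. 2.2.1: the distance between two compact
solutions is non-decreasing). Everything is PROVED; no definitions, no named facts.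

Setting: `K` a compact space, `U ⊆ ℝ` open, `φ φ' : ℝ → K → ℝ` with `(t, k) ↦ φ t k` and
`(t, k) ↦ φ' t k` continuous on `U × K` and `∂ₜφ(·, k) = φ'(·, k)` on `U` for every `k`.

* `exists_isMinOn_iInf_eq` — the minimum `⨅ k, φ t k` is attained (compactness);
* `eventually_forall_abs_sub_lt` — `φ(s, ·) → φ(t, ·)` UNIFORMLY on `K` as `s → t` (tube lemma);
* `continuousAt_iInf` — `t ↦ ⨅ k, φ t k` is continuous on `U`;
* `eventually_isMinOn_mem` — minimisers of `φ(s, ·)` for `s` near `t` lie in any neighbourhood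
  of the set of minimisers of `φ(t, ·)`;
* `hamiltonTrick_iInf` — **Hamilton's trick (Dini form)**: if `m < φ'(t, k)` at every minimiser
  `k` of `φ(t, ·)`, then `m (s - t) ≤ ⨅ φ(s, ·) - ⨅ φ(t, ·)` for all `s > t` near `t`;
* `monotoneOn_iInf` — if `φ'(t, k) ≥ 0` at every minimiser, for all `t ∈ [a, b) ⊆ U`, then
  `t ↦ ⨅ k, φ t k` is non-decreasing on `[a, b]` (Dini's monotonicity criterion, via Mathlib's
  `image_le_of_liminf_slope_right_le_deriv_boundary`); `forall_le_of_forall_le` — lower bounds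
  of `φ(a, ·)` persist on `[a, b]`.

## References

* R. S. Hamilton, *Four-manifolds with positive curvature operator*, J. Differential Geom. 24
  (1986) 153–179, Lemma 3.5. [Hamilton1986]
* C. Mantegazza, *Lecture Notes on Mean Curvature Flow*, Progress in Mathematics 290,
  Birkhäuser 2011, Lemma 2.1.3 and Thm. 2.2.1. [Mantegazza2011]
-/

noncomputable section

open Set Filter Function
open scoped Topology

namespace Literature.Analysis.Calculus

variable {K : Type*} [TopologicalSpace K] [CompactSpace K] {U : Set ℝ} {φ φ' : ℝ → K → ℝ}

/-! ### Minima over a compact set of a jointly continuous function -/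

section Min

omit [CompactSpace K] in
/-- Each time slice `φ(t, ·)`, `t ∈ U`, is continuous. [folklore] -/
theorem continuous_slice (hcont : ContinuousOn (uncurry φ) (U ×ˢ univ)) {t : ℝ} (ht : t ∈ U) :
    Continuous (φ t) := by
  have h : ContinuousOn (uncurry φ ∘ fun k : K ↦ (t, k)) univ :=
    hcont.comp (by fun_prop) fun k _ ↦ ⟨ht, mem_univ k⟩
  exact continuousOn_univ.1 h

/-- **The minimum over a compact set is attained**: for `t ∈ U` there is a minimiser `k` of
`φ(t, ·)`, and `⨅ k, φ t k = φ t k`. [folklore] -/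
theorem exists_isMinOn_iInf_eq [Nonempty K] (hcont : ContinuousOn (uncurry φ) (U ×ˢ univ))
    {t : ℝ} (ht : t ∈ U) : ∃ k, IsMinOn (φ t) univ k ∧ ⨅ k', φ t k' = φ t k := by
  obtain ⟨k, -, hk⟩ := isCompact_univ.exists_isMinOn univ_nonempty
    (continuous_slice hcont ht).continuousOn
  refine ⟨k, hk, le_antisymm (ciInf_le ⟨φ t k, ?_⟩ k) (le_ciInf fun k' ↦ hk (mem_univ k'))⟩
  rintro _ ⟨k', rfl⟩
  exact hk (mem_univ k')

/-- The infimum is a lower bound: `⨅ k, φ t k ≤ φ t k`. [folklore] -/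
theorem iInf_le_apply [Nonempty K] (hcont : ContinuousOn (uncurry φ) (U ×ˢ univ)) {t : ℝ}
    (ht : t ∈ U) (k : K) : ⨅ k', φ t k' ≤ φ t k := by
  obtain ⟨k₀, hk₀, h⟩ := exists_isMinOn_iInf_eq hcont ht
  rw [h]
  exact hk₀ (mem_univ k)

/-- **Uniform continuity in time** (tube lemma): for `t ∈ U` and `ε > 0`, for all `s` near `t`,
`|φ(s, k) - φ(t, k)| < ε` for EVERY `k ∈ K`. [folklore] -/
theorem eventually_forall_abs_sub_lt (hU : IsOpen U) (hcont : ContinuousOn (uncurry φ) (U ×ˢ univ))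
    {t : ℝ} (ht : t ∈ U) {ε : ℝ} (hε : 0 < ε) :
    ∀ᶠ s in 𝓝 t, ∀ k, |φ s k - φ t k| < ε := by
  -- the difference `(s, k) ↦ φ(s, k) - φ(t, k)` is continuous on `U × K` and vanishes on `{t} × K`
  have hdiff : ContinuousOn (fun p : ℝ × K ↦ φ p.1 p.2 - φ t p.2) (U ×ˢ univ) := by
    refine hcont.sub ?_
    have h2 : ContinuousOn (uncurry φ ∘ fun p : ℝ × K ↦ (t, p.2)) (U ×ˢ univ) :=
      hcont.comp (by fun_prop) fun p _ ↦ ⟨ht, mem_univ _⟩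
    exact h2
  have hopen : IsOpen ((U ×ˢ univ) ∩ (fun p : ℝ × K ↦ φ p.1 p.2 - φ t p.2) ⁻¹' Ioo (-ε) ε) :=
    hdiff.isOpen_inter_preimage (hU.prod isOpen_univ) isOpen_Ioo
  have hsub : ({t} : Set ℝ) ×ˢ (univ : Set K) ⊆
      (U ×ˢ univ) ∩ (fun p : ℝ × K ↦ φ p.1 p.2 - φ t p.2) ⁻¹' Ioo (-ε) ε := by
    rintro ⟨s, k⟩ ⟨hs, -⟩
    rw [mem_singleton_iff] at hs
    subst hs
    exact ⟨⟨ht, mem_univ k⟩, by simp [hε]⟩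
  obtain ⟨u, v, hu, -, htu, hKv, huv⟩ :=
    generalized_tube_lemma isCompact_singleton isCompact_univ hopen hsub
  filter_upwards [hu.mem_nhds (htu (mem_singleton t))] with s hs k
  have hk : (s, k) ∈ u ×ˢ v := ⟨hs, hKv (mem_univ k)⟩
  have := (huv hk).2
  rw [mem_preimage, mem_Ioo] at this
  exact abs_sub_lt_iff.2 ⟨by linarith [this.2], by linarith [this.1]⟩

/-- Points of `U` have neighbourhoods in `U` on which the uniform estimate holds; in particular
`s ∈ U` eventually. [folklore] -/
theorem eventually_mem (hU : IsOpen U) {t : ℝ} (ht : t ∈ U) : ∀ᶠ s in 𝓝 t, s ∈ U :=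
  hU.mem_nhds ht

/-- **Continuity of the minimum**: `t ↦ ⨅ k, φ t k` is continuous at every `t ∈ U`.
[cite: Mantegazza2011, Lemma 2.1.3] -/
theorem continuousAt_iInf [Nonempty K] (hU : IsOpen U)
    (hcont : ContinuousOn (uncurry φ) (U ×ˢ univ)) {t : ℝ} (ht : t ∈ U) :
    ContinuousAt (fun s ↦ ⨅ k, φ s k) t := by
  rw [Metric.continuousAt_iff']
  intro ε hε
  filter_upwards [eventually_forall_abs_sub_lt hU hcont ht (half_pos hε), eventually_mem hU ht]
    with s hs hsU
  rw [Real.dist_eq]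
  obtain ⟨kₛ, hkₛ, hseq⟩ := exists_isMinOn_iInf_eq hcont hsU
  obtain ⟨kₜ, hkₜ, hteq⟩ := exists_isMinOn_iInf_eq hcont ht
  have h1 : ⨅ k, φ s k ≤ φ s kₜ := iInf_le_apply hcont hsU kₜ
  have h2 : ⨅ k, φ t k ≤ φ t kₛ := iInf_le_apply hcont ht kₛ
  have h3 := abs_sub_lt_iff.1 (hs kₜ)
  have h4 := abs_sub_lt_iff.1 (hs kₛ)
  rw [hseq, hteq] at *
  exact abs_sub_lt_iff.2 ⟨by linarith, by linarith⟩

/-- `t ↦ ⨅ k, φ t k` is continuous on `U`. [folklore] -/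
theorem continuousOn_iInf [Nonempty K] (hU : IsOpen U)
    (hcont : ContinuousOn (uncurry φ) (U ×ˢ univ)) :
    ContinuousOn (fun s ↦ ⨅ k, φ s k) U := fun _ ht ↦
  (continuousAt_iInf hU hcont ht).continuousWithinAt

/-- **Minimisers move little**: if `V` is an open set containing every minimiser of `φ(t, ·)`,
then for `s` near `t` every minimiser of `φ(s, ·)` lies in `V` (on the compact `K \ V`,
`φ(t, ·) ≥ min + η` for some `η > 0`, and `φ(s, ·)` is uniformly `η/2`-close to `φ(t, ·)`).
[cite: Mantegazza2011, Lemma 2.1.3 (proof)] -/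
theorem eventually_isMinOn_mem [Nonempty K] (hU : IsOpen U)
    (hcont : ContinuousOn (uncurry φ) (U ×ˢ univ)) {t : ℝ} (ht : t ∈ U) {V : Set K}
    (hV : IsOpen V) (hmin : ∀ k, IsMinOn (φ t) univ k → k ∈ V) :
    ∀ᶠ s in 𝓝 t, ∀ k, IsMinOn (φ s) univ k → k ∈ V := by
  obtain ⟨kₜ, hkₜ, hteq⟩ := exists_isMinOn_iInf_eq hcont ht
  -- a positive margin `η` on the compact complement of `V`
  have hcpt : IsCompact Vᶜ := hV.isClosed_compl.isCompact
  have hlt : ∀ k ∈ Vᶜ, φ t kₜ < φ t k := by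
    intro k hk
    have hle : φ t kₜ ≤ φ t k := hkₜ (mem_univ k)
    rcases hle.lt_or_eq with h | h
    · exact h
    · refine absurd (hmin k fun k' _ ↦ ?_) hk
      have h' : φ t kₜ ≤ φ t k' := hkₜ (mem_univ k')
      change φ t k ≤ φ t k'
      rw [← h]
      exact h'
  obtain ⟨c, hc, hcle⟩ := hcpt.exists_forall_le' (continuous_slice hcont ht).continuousOn hlt
  set η := c - φ t kₜ with hη
  have hηpos : 0 < η := by rw [hη]; linarith
  filter_upwards [eventually_forall_abs_sub_lt hU hcont ht (half_pos hηpos)] with s hs k hk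
  by_contra hkV
  have h1 := abs_sub_lt_iff.1 (hs k)      -- `φ s k > φ t k - η/2 ≥ c - η/2`
  have h2 := abs_sub_lt_iff.1 (hs kₜ)     -- `φ s kₜ < φ t kₜ + η/2`
  have h3 : φ s k ≤ φ s kₜ := hk (mem_univ kₜ)
  have h4 : c ≤ φ t k := hcle k hkV
  rw [hη] at h1 h2
  linarith

end Min

/-! ### Hamilton's trick -/

section Trick

/-- **Hamilton's trick (one-sided, at every time).** Let `K` be compact, `U ⊆ ℝ` open,
`φ, ∂ₜφ = φ'` jointly continuous on `U × K`. If at time `t ∈ U` one has `m < φ'(t, k)` at EVERY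
minimiser `k` of `φ(t, ·)`, then for all `s > t` sufficiently close to `t`,
`m · (s - t) ≤ min φ(s, ·) - min φ(t, ·)`; i.e. the lower right Dini derivative of
`u = min_K φ` at `t` is `≥ inf {∂ₜφ(t, k) : k minimiser}`. (Hamilton 1986, Lemma 3.5, states the
two-sided version at differentiability times of the locally Lipschitz `u`, for maxima:
`u' ≤ sup {∂ₜφ(t, k) : k maximiser}`.) Proof: by joint continuity of `φ'` and compactness of the
set of minimisers there are `δ > 0` and an open `V ⊇ {minimisers}` with `φ' > m` on
`(t - δ, t + δ) × V`; minimisers `kₛ` of `φ(s, ·)` lie in `V` for `s` near `t`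
(`eventually_isMinOn_mem`), and the mean value inequality on `[t, s]` for `φ(·, kₛ)` gives
`u(s) = φ(s, kₛ) ≥ φ(t, kₛ) + m (s - t) ≥ u(t) + m (s - t)`.
[cite: Hamilton1986, Lemma 3.5] [cite: Mantegazza2011, Lemma 2.1.3] -/
theorem hamiltonTrick_iInf [Nonempty K] (hU : IsOpen U)
    (hcont : ContinuousOn (uncurry φ) (U ×ˢ univ))
    (hderiv : ∀ s ∈ U, ∀ k, HasDerivAt (fun r ↦ φ r k) (φ' s k) s)
    (hcont' : ContinuousOn (uncurry φ') (U ×ˢ univ)) {t : ℝ} (ht : t ∈ U) {m : ℝ}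
    (hm : ∀ k, IsMinOn (φ t) univ k → m < φ' t k) :
    ∀ᶠ s in 𝓝[>] t, m * (s - t) ≤ (⨅ k, φ s k) - ⨅ k, φ t k := by
  -- Step 1: `φ' > m` on a product neighbourhood `u × V` of `{t} × {minimisers}`
  set Kt : Set K := {k | IsMinOn (φ t) univ k} with hKt
  have hKtc : IsClosed Kt := by
    have : Kt = ⋂ k', {k | φ t k ≤ φ t k'} := by
      ext k
      simp only [hKt, mem_setOf_eq, mem_iInter, isMinOn_univ_iff]
    rw [this]
    exact isClosed_iInter fun k' ↦
      isClosed_le (continuous_slice hcont ht) continuous_const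
  have hopen : IsOpen ((U ×ˢ univ) ∩ uncurry φ' ⁻¹' Ioi m) :=
    hcont'.isOpen_inter_preimage (hU.prod isOpen_univ) isOpen_Ioi
  have hsub : ({t} : Set ℝ) ×ˢ Kt ⊆ (U ×ˢ univ) ∩ uncurry φ' ⁻¹' Ioi m := by
    rintro ⟨s, k⟩ ⟨hs, hk⟩
    rw [mem_singleton_iff] at hs
    subst hs
    exact ⟨⟨ht, mem_univ k⟩, hm k hk⟩
  obtain ⟨u, V, hu, hV, htu, hKV, huV⟩ :=
    generalized_tube_lemma isCompact_singleton hKtc.isCompact hopen hsub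
  have htu' : t ∈ u := htu (mem_singleton t)
  -- an interval `[t, t + δ) ⊆ u`
  obtain ⟨δ, hδ, hball⟩ := Metric.isOpen_iff.1 hu t htu'
  -- Step 2: minimisers of `φ(s, ·)` lie in `V` for `s` near `t`
  have hminV := eventually_isMinOn_mem hU hcont ht hV fun k hk ↦ hKV hk
  have hright : ∀ᶠ s in 𝓝[>] t, s ∈ Ioo t (t + δ) := Ioo_mem_nhdsGT (by linarith)
  filter_upwards [hright, nhdsWithin_le_nhds hminV, nhdsWithin_le_nhds (eventually_mem hU ht)]
    with s hs hsV hsU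
  obtain ⟨kₛ, hkₛ, hseq⟩ := exists_isMinOn_iInf_eq hcont hsU
  have hkV : kₛ ∈ V := hsV kₛ hkₛ
  -- `[t, s] ⊆ u ⊆ U`, and `φ' (·, kₛ) > m` there
  have hIu : Icc t s ⊆ u := fun r hr ↦ hball (by
    rw [Metric.mem_ball, Real.dist_eq, abs_lt]
    constructor <;> linarith [hr.1, hr.2, hs.2])
  have hmem : ∀ r ∈ Icc t s, ((r, kₛ) : ℝ × K) ∈ (U ×ˢ univ) ∩ uncurry φ' ⁻¹' Ioi m :=
    fun r hr ↦ huV (mk_mem_prod (hIu hr) hkV)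
  have hIU : Icc t s ⊆ U := fun r hr ↦ (hmem r hr).1.1
  have hgt : ∀ r ∈ Icc t s, m < φ' r kₛ := fun r hr ↦ (hmem r hr).2
  -- Step 3: the mean value inequality for `r ↦ φ r kₛ` on `[t, s]`
  have hcont1 : ContinuousOn (fun r ↦ φ r kₛ) (Icc t s) := fun r hr ↦
    (hderiv r (hIU hr) kₛ).continuousAt.continuousWithinAt
  have hdiff1 : DifferentiableOn ℝ (fun r ↦ φ r kₛ) (interior (Icc t s)) := fun r hr ↦
    (hderiv r (hIU (interior_subset hr)) kₛ).differentiableAt.differentiableWithinAt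
  have hge : ∀ r ∈ interior (Icc t s), m ≤ deriv (fun r ↦ φ r kₛ) r := fun r hr ↦ by
    rw [(hderiv r (hIU (interior_subset hr)) kₛ).deriv]
    exact (hgt r (interior_subset hr)).le
  have hmvt := (convex_Icc t s).mul_sub_le_image_sub_of_le_deriv hcont1 hdiff1 hge
    t (left_mem_Icc.2 hs.1.le) s (right_mem_Icc.2 hs.1.le) hs.1.le
  -- Step 4: assemble
  have h1 : ⨅ k, φ t k ≤ φ t kₛ := iInf_le_apply hcont ht kₛ
  rw [hseq]
  linarith

end Trick

/-! ### Monotonicity of the minimum -/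

section Monotone

/-- **Dini's criterion applied to Hamilton's trick: the minimum is non-decreasing.** If
`[a, b] ⊆ U` and `∂ₜφ(t, k) ≥ 0` at every minimiser `k` of `φ(t, ·)` for every `t ∈ [a, b)`,
then `min_K φ(a, ·) ≤ min_K φ(x, ·)` for all `x ∈ [a, b]`. By `hamiltonTrick_iInf` with
`m = -r < 0`, the lower right Dini derivative of `u = min φ` is `≥ 0` on `[a, b)`; a continuous
function with this property is non-decreasing (Mathlib's
`image_le_of_liminf_slope_right_le_deriv_boundary`, applied to `-u` with the constant bound).
[cite: Mantegazza2011, Lemma 2.1.3 and Thm. 2.2.1 (proof)] -/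
theorem iInf_le_iInf_of_mem_Icc [Nonempty K] (hU : IsOpen U)
    (hcont : ContinuousOn (uncurry φ) (U ×ˢ univ))
    (hderiv : ∀ s ∈ U, ∀ k, HasDerivAt (fun r ↦ φ r k) (φ' s k) s)
    (hcont' : ContinuousOn (uncurry φ') (U ×ˢ univ)) {a b : ℝ} (hab : Icc a b ⊆ U)
    (hsign : ∀ t ∈ Ico a b, ∀ k, IsMinOn (φ t) univ k → 0 ≤ φ' t k) {x : ℝ} (hx : x ∈ Icc a b) :
    ⨅ k, φ a k ≤ ⨅ k, φ x k := by
  set u : ℝ → ℝ := fun s ↦ ⨅ k, φ s k with hu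
  have hucont : ContinuousOn u (Icc a b) := (continuousOn_iInf hU hcont).mono hab
  have key := image_le_of_liminf_slope_right_le_deriv_boundary (f := fun s ↦ -u s)
    (B := fun _ ↦ -u a) (B' := fun _ ↦ 0) hucont.neg (le_refl _) continuousOn_const
    (fun _ _ ↦ hasDerivWithinAt_const _ _ _) ?_ hx
  · simpa using key
  intro t ht r hr
  have htU : t ∈ U := hab (Ico_subset_Icc_self ht)
  have hm : ∀ k, IsMinOn (φ t) univ k → -(r / 2) < φ' t k := fun k hk ↦
    lt_of_lt_of_le (neg_lt_zero.2 (half_pos hr)) (hsign t ht k hk)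
  have hev := hamiltonTrick_iInf hU hcont hderiv hcont' htU hm
  refine (hev.and self_mem_nhdsWithin).mono (fun s ⟨hs, hst⟩ ↦ ?_) |>.frequently
  replace hst : t < s := hst
  rw [slope_def_field]
  have hpos : 0 < s - t := sub_pos.2 hst
  rw [div_lt_iff₀ hpos]
  have : -u s - -u t = -(u s - u t) := by ring
  rw [this]
  simp only [hu] at hs ⊢
  nlinarith

/-- **The minimum over `K` is non-decreasing on `[a, b]`** under the hypotheses of
`iInf_le_iInf_of_mem_Icc` (apply it on every `[s, b] ⊆ [a, b]`). This is the abstract form of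
the comparison principle for mean curvature flow (Mantegazza 2011, Thm. 2.2.1: with
`φ(t, (p, q)) = |F¹ₜ(p) - F²ₜ(q)|²` the distance between two compact solutions is
non-decreasing). [cite: Mantegazza2011, Lemma 2.1.3 and Thm. 2.2.1] [cite: Hamilton1986, Lemma 3.5] -/
theorem monotoneOn_iInf [Nonempty K] (hU : IsOpen U)
    (hcont : ContinuousOn (uncurry φ) (U ×ˢ univ))
    (hderiv : ∀ s ∈ U, ∀ k, HasDerivAt (fun r ↦ φ r k) (φ' s k) s)
    (hcont' : ContinuousOn (uncurry φ') (U ×ˢ univ)) {a b : ℝ} (hab : Icc a b ⊆ U)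
    (hsign : ∀ t ∈ Ico a b, ∀ k, IsMinOn (φ t) univ k → 0 ≤ φ' t k) :
    MonotoneOn (fun t ↦ ⨅ k, φ t k) (Icc a b) := by
  intro s hs x hx hsx
  have hsb : Icc s b ⊆ Icc a b := Icc_subset_Icc hs.1 le_rfl
  exact iInf_le_iInf_of_mem_Icc hU hcont hderiv hcont' (hsb.trans hab)
    (fun t ht ↦ hsign t ⟨hs.1.trans ht.1, ht.2⟩) ⟨hsx, hx.2⟩

/-- **Lower bounds persist**: under the same hypotheses, if `c ≤ φ(a, k)` for all `k`, then
`c ≤ φ(t, k)` for all `t ∈ [a, b]` and all `k` (no nonemptiness needed).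
[cite: Mantegazza2011, Thm. 2.2.1] -/
theorem forall_le_of_forall_le (hU : IsOpen U)
    (hcont : ContinuousOn (uncurry φ) (U ×ˢ univ))
    (hderiv : ∀ s ∈ U, ∀ k, HasDerivAt (fun r ↦ φ r k) (φ' s k) s)
    (hcont' : ContinuousOn (uncurry φ') (U ×ˢ univ)) {a b : ℝ} (hab : Icc a b ⊆ U)
    (hsign : ∀ t ∈ Ico a b, ∀ k, IsMinOn (φ t) univ k → 0 ≤ φ' t k) {c : ℝ}
    (hc : ∀ k, c ≤ φ a k) {t : ℝ} (ht : t ∈ Icc a b) (k : K) : c ≤ φ t k := by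
  haveI : Nonempty K := ⟨k⟩
  have h1 : c ≤ ⨅ k, φ a k := le_ciInf hc
  have h2 := iInf_le_iInf_of_mem_Icc hU hcont hderiv hcont' hab hsign ht
  exact h1.trans (h2.trans (iInf_le_apply hcont (hab ht) k))

end Monotone

end Literature.Analysis.Calculus

end
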